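import Summits.BirchSwinnertonDyer.BirchSwinnertonDyer.Theorems.Rank2ObservatoryReductionWitnessT8
import HarnessLib

/-!
# BirchSwinnertonDyer — rank ≥ 2 observatory: the rank-2 kernel certificate `T8` (torsion class `ℤ/8`)

HONEST FRAMING: per-curve certified theorems and census instruments; no claim on BSD in rank ≥ 2.

Second half of the `u = 3` level (see `Rank2ObservatoryReductionWitnessT8` for `halfT4OnlyB` and
`eightTorsion_eq : E(ℚ)[8] = {O, T, ±T₄, ±T₈, ±T₈'}`): no rational point of order `16` from ONE good
prime `ℓ₂` at which `T̃₈` is no double (`eight_nsmul_eq_zero_of_eightTorsionWitness`), the sharpened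
annihilator `8m` (`torsion_zsmul_eq_zero_of_eightTorsionWitness`), the coset lemma in witness form
(`not_mem_twoCoset_three_of_tCosetFree`: `R̃, R̃ + T̃₈ ∉ 2Ẽ(𝔽_q)` gives `R ∉ 2E(ℚ) + E(ℚ)[8]`), and
the certificate `two_le_mordellWeilRank_of_kernelCertT8` used per curve for the two `ℤ/8` rows of the
rank-2 census below conductor `500000` (`253506bg3`, `308490bx1`). Integral points throughout (scaled
model per curve via `mordellWeilRank_scaleModel`). Sorry-free; no new axioms. References: Silverman
AEC (2009) III.2.3, VII.3.1(b), VII.3.4, VIII.6.7; Cremona (1997) §3.5.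
-/

-- single-conjunct summit: `Summit.BirchSwinnertonDyer.BirchSwinnertonDyer.…` repeats the name by design
set_option linter.dupNamespace false

namespace Summit.BirchSwinnertonDyer.BirchSwinnertonDyer.Rank2Observatory

open WeierstrassCurve Literature.NumberTheory.EllipticCurves

/-! ### No point of order `16`; the annihilator `8m` -/

section EightTorsionWitness

variable (V : WeierstrassCurve ℤ)


open scoped Classical in
/-- **No point of order `16` in `E(ℚ)`** from the `ℤ/8` data of `eightTorsion_eq` and a good prime
`ℓ₂` at which `T̃₈` is no double (`xDoubleFree V ℓ₂ x₈`): `16 • w = 0 → 8 • w = 0` (`2w ∈ E(ℚ)[8]`;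
`2w ∈ {±T₈, ±T₈'}` would make `T̃₈` a double mod `ℓ₂`, so `2w ∈ {O, T, ±T₄}` and `8w = 0`).
[cite: SilvermanAEC2009, Prop. VII.3.1(b)] -/
theorem eight_nsmul_eq_zero_of_eightTorsionWitness {xT yT x₄ y₄ x₈ y₈ x₈' y₈' : ℤ}
    (hT : yT ^ 2 + V.a₁ * xT * yT + V.a₃ * yT = xT ^ 3 + V.a₂ * xT ^ 2 + V.a₄ * xT + V.a₆)
    (hT2 : 2 * yT + V.a₁ * xT + V.a₃ = 0)
    (h₄ : y₄ ^ 2 + V.a₁ * x₄ * y₄ + V.a₃ * y₄ = x₄ ^ 3 + V.a₂ * x₄ ^ 2 + V.a₄ * x₄ + V.a₆)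
    (htan₄ : intTangent V x₄ y₄ xT yT = true)
    (h₈ : y₈ ^ 2 + V.a₁ * x₈ * y₈ + V.a₃ * y₈ = x₈ ^ 3 + V.a₂ * x₈ ^ 2 + V.a₄ * x₈ + V.a₆)
    (htan₈ : intTangent V x₈ y₈ x₄ y₄ = true)
    (h₈' : y₈' ^ 2 + V.a₁ * x₈' * y₈' + V.a₃ * y₈' = x₈' ^ 3 + V.a₂ * x₈' ^ 2 + V.a₄ * x₈' + V.a₆)
    (hchord : intChord V x₈ y₈ x₄ y₄ x₈' y₈' = true)
    (ℓ₁ : ℕ) [Fact ℓ₁.Prime] (hℓ₁ : ¬ (ℓ₁ : ℤ) ∣ V.Δ) (hodd : ℓ₁ ≠ 2)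
    (hB₁ : twoTorsionOnlyB V ℓ₁ xT yT = true) (hB₂ : halfTOnlyB V ℓ₁ xT x₄ y₄ = true)
    (hB₂' : halfT4OnlyB V ℓ₁ x₄ x₈ y₈ x₈' y₈' = true)
    (ℓ₂ : ℕ) [Fact ℓ₂.Prime] (hℓ₂ : ¬ (ℓ₂ : ℤ) ∣ V.Δ) (hB₃ : xDoubleFree V ℓ₂ (x₈ : ZMod ℓ₂) = true)
    (w : (V.map (Int.castRingHom ℚ)).toAffine.Point) (h : 16 • w = 0) : 8 • w = 0 := by
  have hΔ : V.Δ ≠ 0 := Δ_ne_zero_of_not_dvd V hℓ₁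
  haveI := isElliptic_rat V hΔ
  have e₈ : V.toAffine.Equation x₈ y₈ := (Affine.equation_iff x₈ y₈).mpr h₈
  set T : (V.map (Int.castRingHom ℚ)).toAffine.Point :=
    .some (xT : ℚ) (yT : ℚ) (nonsingular_rat_of_eq V hΔ hT) with hTdef
  set T₄ : (V.map (Int.castRingHom ℚ)).toAffine.Point :=
    .some (x₄ : ℚ) (y₄ : ℚ) (nonsingular_rat_of_eq V hΔ h₄) with hT₄def
  set T₈ : (V.map (Int.castRingHom ℚ)).toAffine.Point :=
    .some (x₈ : ℚ) (y₈ : ℚ) (nonsingular_rat_of_eq V hΔ h₈) with hT₈def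
  set T₈' : (V.map (Int.castRingHom ℚ)).toAffine.Point :=
    .some (x₈' : ℚ) (y₈' : ℚ) (nonsingular_rat_of_eq V hΔ h₈') with hT₈'def
  have h2T₄ : 2 • T₄ = T := by rw [two_nsmul]; exact some_add_self_of_intTangent V hΔ h₄ hT htan₄
  have h2T₈ : 2 • T₈ = T₄ := by rw [two_nsmul]; exact some_add_self_of_intTangent V hΔ h₈ h₄ htan₈
  have h38 : T₈ + T₄ = T₈' := some_add_some_of_intChord V hΔ h₈ h₄ h₈' hchord
  have h2T : 2 • T = 0 := two_nsmul_some_eq_zero V hΔ hT hT2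
  -- `2w` is `8`-torsion
  have h82w : (2 : ℤ) ^ 3 • (2 • w) = 0 := by
    have : (8 : ℕ) • (2 • w) = 0 := by
      rw [← mul_nsmul', show (8 : ℕ) * 2 = 16 from rfl]; exact h
    rw [show ((2 : ℤ) ^ 3) = ((8 : ℕ) : ℤ) by norm_num, natCast_zsmul]; exact this
  -- `T̃₈` is no double mod `ℓ₂`
  have hnot : ∀ v : (V.map (Int.castRingHom ℚ)).toAffine.Point, 2 • v ≠ T₈ := by
    intro v hv
    have hmem : (Affine.Point.some (x₈ : ZMod ℓ₂) (y₈ : ZMod ℓ₂)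
        (nonsingular_zmod_of_equation V ℓ₂ hℓ₂ e₈) :
          (V.map (Int.castRingHom (ZMod ℓ₂))).toAffine.Point)
          ∈ twoCoset (V.map (Int.castRingHom (ZMod ℓ₂))).toAffine.Point 0 := by
      refine ⟨reduceMod V ℓ₂ hℓ₂ v, 0, by simp, ?_⟩
      rw [two_zsmul, add_zero, ← two_nsmul, ← map_nsmul, hv, hT₈def, reduceMod_some V ℓ₂ hℓ₂ e₈]
    exact not_mem_twoCoset_of_xDoubleFree V ℓ₂ hB₃ _ hmem
  have h8w : 8 • w = 2 • (2 • (2 • w)) := by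
    rw [show (8 : ℕ) = 2 * 2 * 2 from rfl, mul_nsmul, mul_nsmul]
  rcases eightTorsion_eq V hT hT2 h₄ htan₄ h₈ htan₈ h₈' hchord ℓ₁ hℓ₁ hodd hB₁ hB₂ hB₂' (2 • w) h82w
    with h0 | h1 | h2 | h3 | h5 | h6 | h7 | h9
  · rw [h8w, h0, nsmul_zero, nsmul_zero]
  · rw [h8w, h1, ← hTdef, h2T, nsmul_zero]
  · rw [h8w, h2, ← hT₄def, h2T₄, h2T]
  · rw [h8w, h3, ← hT₄def, neg_nsmul, h2T₄, neg_nsmul, h2T, neg_zero]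
  · exact absurd h5 (hnot w)
  · exfalso
    apply hnot (-w)
    rw [neg_nsmul, h6, ← hT₈def, neg_neg]
  · exfalso
    apply hnot (w - T₈)
    rw [nsmul_sub, h7, ← hT₈'def, h2T₈, ← h38, add_sub_cancel_right]
  · exfalso
    apply hnot (-w - T₈)
    rw [nsmul_sub, neg_nsmul, h9, ← hT₈'def, neg_neg, h2T₈, ← h38, add_sub_cancel_right]

open scoped Classical in
/-- **`8m` kills `E(ℚ)_tors`** when `t = 2^e·m` does (`annihilatorCheck`) and `E(ℚ)` has no point of
order `16` by `eight_nsmul_eq_zero_of_eightTorsionWitness` (descent `2^(k+3)•z = 0 → 8•z = 0`).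
[cite: SilvermanAEC2009, Prop. VII.3.1(b), Thm. VII.3.4] -/
theorem torsion_zsmul_eq_zero_of_eightTorsionWitness {S : List (ℕ × ℕ)} {t e m : ℕ}
    (hte : t = 2 ^ e * m)
    (hS : ∀ ℓN ∈ S, ℓN.1.Prime ∧
      ∀ (x : (V.map (Int.castRingHom ℚ)).toAffine.Point) (n : ℕ), ¬ ℓN.1 ∣ n → n • x = 0 →
        ℓN.2 • x = 0)
    (ht : annihilatorCheck S t = true) {xT yT x₄ y₄ x₈ y₈ x₈' y₈' : ℤ}
    (hT : yT ^ 2 + V.a₁ * xT * yT + V.a₃ * yT = xT ^ 3 + V.a₂ * xT ^ 2 + V.a₄ * xT + V.a₆)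
    (hT2 : 2 * yT + V.a₁ * xT + V.a₃ = 0)
    (h₄ : y₄ ^ 2 + V.a₁ * x₄ * y₄ + V.a₃ * y₄ = x₄ ^ 3 + V.a₂ * x₄ ^ 2 + V.a₄ * x₄ + V.a₆)
    (htan₄ : intTangent V x₄ y₄ xT yT = true)
    (h₈ : y₈ ^ 2 + V.a₁ * x₈ * y₈ + V.a₃ * y₈ = x₈ ^ 3 + V.a₂ * x₈ ^ 2 + V.a₄ * x₈ + V.a₆)
    (htan₈ : intTangent V x₈ y₈ x₄ y₄ = true)
    (h₈' : y₈' ^ 2 + V.a₁ * x₈' * y₈' + V.a₃ * y₈' = x₈' ^ 3 + V.a₂ * x₈' ^ 2 + V.a₄ * x₈' + V.a₆)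
    (hchord : intChord V x₈ y₈ x₄ y₄ x₈' y₈' = true)
    (ℓ₁ : ℕ) [Fact ℓ₁.Prime] (hℓ₁ : ¬ (ℓ₁ : ℤ) ∣ V.Δ) (hodd : ℓ₁ ≠ 2)
    (hB₁ : twoTorsionOnlyB V ℓ₁ xT yT = true) (hB₂ : halfTOnlyB V ℓ₁ xT x₄ y₄ = true)
    (hB₂' : halfT4OnlyB V ℓ₁ x₄ x₈ y₈ x₈' y₈' = true)
    (ℓ₂ : ℕ) [Fact ℓ₂.Prime] (hℓ₂ : ¬ (ℓ₂ : ℤ) ∣ V.Δ) (hB₃ : xDoubleFree V ℓ₂ (x₈ : ZMod ℓ₂) = true)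
    (x : (V.map (Int.castRingHom ℚ)).toAffine.Point) (hx : IsOfFinAddOrder x) :
    ((2 : ℤ) ^ 3 * (m : ℤ)) • x = 0 := by
  have htx : t • x = 0 := nsmul_eq_zero_of_annihilatorCheck hS ht hx
  rw [hte, mul_nsmul'] at htx
  rw [show ((2 : ℤ) ^ 3 * (m : ℤ)) = ((8 * m : ℕ) : ℤ) by push_cast; ring, natCast_zsmul, mul_nsmul']
  -- descend: `2^(k+3) • z = 0 → 8 • z = 0`
  have key : ∀ k : ℕ, ∀ z : (V.map (Int.castRingHom ℚ)).toAffine.Point,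
      2 ^ (k + 3) • z = 0 → 8 • z = 0 := by
    intro k
    induction k with
    | zero => intro z hz; simpa using hz
    | succ k ih =>
      intro z hz
      apply ih
      have hz16 : 16 • (2 ^ k • z) = 0 := by
        rw [← mul_nsmul', show 16 * 2 ^ k = 2 ^ (k + 1 + 3) by ring]; exact hz
      have h8 := eight_nsmul_eq_zero_of_eightTorsionWitness V hT hT2 h₄ htan₄ h₈ htan₈ h₈' hchord ℓ₁
        hℓ₁ hodd hB₁ hB₂ hB₂' ℓ₂ hℓ₂ hB₃ (2 ^ k • z) hz16
      rwa [← mul_nsmul', show 8 * 2 ^ k = 2 ^ (k + 3) by ring] at h8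
  match e, htx with
  | 0, htx => rw [pow_zero, one_nsmul] at htx; rw [htx, nsmul_zero]
  | 1, htx =>
      rw [pow_one] at htx
      rw [show (8 : ℕ) = 2 * 2 * 2 from rfl, mul_nsmul, mul_nsmul, htx, nsmul_zero, nsmul_zero]
  | 2, htx =>
      rw [show (2 ^ 2 : ℕ) = 2 * 2 from rfl, mul_nsmul] at htx
      rw [show (8 : ℕ) = 2 * 2 * 2 from rfl, mul_nsmul, mul_nsmul, htx, nsmul_zero]
  | k + 3, htx => exact key k _ htx

end EightTorsionWitness

/-! ### The coset lemma and the rank-2 certificate variant `T8` -/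

section Assembly

variable (V : WeierstrassCurve ℤ)

open scoped Classical in
/-- Soundness of `tCosetFree` at `2`-exponent `u = 3`: with `E(ℚ)[8] ⊆ {O, T, ±T₄, ±T₈, ±T₈'}`,
`2T₄ = T`, `2T₈ = T₄`, `T₈' = T₈ + T₄`, a rational point `R` whose reduction passes `tCosetFree`
(w.r.t. `T̃₈`) at a good prime `q` is not in `2E(ℚ) + E(ℚ)[8]`. [cite: SilvermanAEC2009, Prop. VII.3.1(b)] -/
theorem not_mem_twoCoset_three_of_tCosetFree (q : ℕ) [Fact q.Prime] (hq : ¬ (q : ℤ) ∣ V.Δ)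
    {T T₄ T₈ T₈' R : (V.map (Int.castRingHom ℚ)).toAffine.Point}
    (h2T₄ : T₄ + T₄ = T) (h2T₈ : T₈ + T₈ = T₄) (h38 : T₈ + T₄ = T₈')
    (h8 : ∀ τ : (V.map (Int.castRingHom ℚ)).toAffine.Point, (2 : ℤ) ^ 3 • τ = 0 →
      τ = 0 ∨ τ = T ∨ τ = T₄ ∨ τ = -T₄ ∨ τ = T₈ ∨ τ = -T₈ ∨ τ = T₈' ∨ τ = -T₈')
    {x₈ y₈ α β α' β' : ZMod q}
    {hns₈ : (V.map (Int.castRingHom (ZMod q))).toAffine.Nonsingular x₈ y₈}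
    {hns : (V.map (Int.castRingHom (ZMod q))).toAffine.Nonsingular α β}
    (hT₈red : reduceMod V q hq T₈ = .some x₈ y₈ hns₈) (hR : reduceMod V q hq R = .some α β hns)
    (hfree : tCosetFree V q x₈ y₈ α β α' β' = true) :
    R ∉ twoCoset (V.map (Int.castRingHom ℚ)).toAffine.Point 3 := by
  simp only [tCosetFree, Bool.and_eq_true] at hfree
  obtain ⟨hc, hα, hα'⟩ := hfree
  apply not_mem_twoCoset_three_of_eightTorsion_subset h2T₄ h2T₈ h38 h8
  · apply not_mem_twoCoset_of_map_not_mem (reduceMod V q hq)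
    rw [hR]
    exact not_mem_twoCoset_of_xDoubleFree V q hα hns
  · apply not_mem_twoCoset_of_map_not_mem (reduceMod V q hq)
    obtain ⟨h₃, e⟩ := exists_some_add_some_of_zmodChord V q hns hns₈ hc
    rw [map_add, hR, hT₈red, e]
    exact not_mem_twoCoset_of_xDoubleFree V q hα' h₃

/-- **Rank-2 kernel certificate for `E(ℚ)_tors ⊇ ℤ/8`**: integral points `P₁, P₂`; torsion
annihilator `t = 2^e·m` from kernel point counts; integral `T = (x_T, y_T)` with
`2y_T + a₁x_T + a₃ = 0`, `T₄ = (x₄, y₄)` with `2T₄ = T` and `T₈ = (x₈, y₈)` with `2T₈ = T₄`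
(`intTangent`), `T₈' = (x₈', y₈') = T₈ + T₄` (`intChord`); a good odd prime `ℓ₁` with
`twoTorsionOnlyB`, `halfTOnlyB`, `halfT4OnlyB` (`E(ℚ)[8] = ⟨T₈⟩`) and a good prime `ℓ₂` at which `T̃₈`
is no double (no rational `16`-torsion, so `8m` kills `E(ℚ)_tors`); for each of `P₁`, `P₂`, `P₁ + P₂`
a good prime `q` with `tCosetFree` w.r.t. `T̃₈` (`R̃, R̃ + T̃₈ ∉ 2Ẽ(𝔽_q)`), the sum supplied by a chord
certificate mod `q₁₂`. Then `2 ≤ rank_ℤ E(ℚ)`.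
[cite: CremonaAlgorithms1997, §3.5] [cite: SilvermanAEC2009, Thm. VIII.6.7] -/
theorem two_le_mordellWeilRank_of_kernelCertT8 {X₁ Y₁ X₂ Y₂ : ℤ}
    (h₁ : Y₁ ^ 2 + V.a₁ * X₁ * Y₁ + V.a₃ * Y₁ = X₁ ^ 3 + V.a₂ * X₁ ^ 2 + V.a₄ * X₁ + V.a₆)
    (h₂ : Y₂ ^ 2 + V.a₁ * X₂ * Y₂ + V.a₃ * Y₂ = X₂ ^ 3 + V.a₂ * X₂ ^ 2 + V.a₄ * X₂ + V.a₆)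
    {S : List (ℕ × ℕ)} {t e m : ℕ} (hm : m % 2 = 1) (hte : t = 2 ^ e * m)
    (hS : ∀ ℓN ∈ S, ℓN.1.Prime ∧
      ∀ (x : (V.map (Int.castRingHom ℚ)).toAffine.Point) (n : ℕ), ¬ ℓN.1 ∣ n → n • x = 0 →
        ℓN.2 • x = 0)
    (ht : annihilatorCheck S t = true)
    {xT yT x₄ y₄ x₈ y₈ x₈' y₈' : ℤ}
    (hT : yT ^ 2 + V.a₁ * xT * yT + V.a₃ * yT = xT ^ 3 + V.a₂ * xT ^ 2 + V.a₄ * xT + V.a₆)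
    (hT2 : 2 * yT + V.a₁ * xT + V.a₃ = 0)
    (h₄ : y₄ ^ 2 + V.a₁ * x₄ * y₄ + V.a₃ * y₄ = x₄ ^ 3 + V.a₂ * x₄ ^ 2 + V.a₄ * x₄ + V.a₆)
    (htan₄ : intTangent V x₄ y₄ xT yT = true)
    (h₈ : y₈ ^ 2 + V.a₁ * x₈ * y₈ + V.a₃ * y₈ = x₈ ^ 3 + V.a₂ * x₈ ^ 2 + V.a₄ * x₈ + V.a₆)
    (htan₈ : intTangent V x₈ y₈ x₄ y₄ = true)
    (h₈' : y₈' ^ 2 + V.a₁ * x₈' * y₈' + V.a₃ * y₈' = x₈' ^ 3 + V.a₂ * x₈' ^ 2 + V.a₄ * x₈' + V.a₆)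
    (hchord : intChord V x₈ y₈ x₄ y₄ x₈' y₈' = true)
    (ℓ₁ : ℕ) [Fact ℓ₁.Prime] (hℓ₁ : ¬ (ℓ₁ : ℤ) ∣ V.Δ) (hodd : ℓ₁ ≠ 2)
    (hB₁ : twoTorsionOnlyB V ℓ₁ xT yT = true) (hB₂ : halfTOnlyB V ℓ₁ xT x₄ y₄ = true)
    (hB₂' : halfT4OnlyB V ℓ₁ x₄ x₈ y₈ x₈' y₈' = true)
    (ℓ₂ : ℕ) [Fact ℓ₂.Prime] (hℓ₂ : ¬ (ℓ₂ : ℤ) ∣ V.Δ) (hB₃ : xDoubleFree V ℓ₂ (x₈ : ZMod ℓ₂) = true)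
    (q₁ q₂ q₁₂ : ℕ) [Fact q₁.Prime] [Fact q₂.Prime] [Fact q₁₂.Prime]
    (hq₁ : ¬ (q₁ : ℤ) ∣ V.Δ) (hq₂ : ¬ (q₂ : ℤ) ∣ V.Δ) (hq₁₂ : ¬ (q₁₂ : ℤ) ∣ V.Δ)
    {A₁ B₁ : ℤ}
    (hw₁ : tCosetFree V q₁ (x₈ : ZMod q₁) (y₈ : ZMod q₁) (X₁ : ZMod q₁) (Y₁ : ZMod q₁)
      (A₁ : ZMod q₁) (B₁ : ZMod q₁) = true)
    {A₂ B₂ : ℤ}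
    (hw₂ : tCosetFree V q₂ (x₈ : ZMod q₂) (y₈ : ZMod q₂) (X₂ : ZMod q₂) (Y₂ : ZMod q₂)
      (A₂ : ZMod q₂) (B₂ : ZMod q₂) = true)
    {X₁₂ Y₁₂ A₁₂ B₁₂ : ℤ}
    (hc₁₂ : zmodChord V q₁₂ (X₁ : ZMod q₁₂) (Y₁ : ZMod q₁₂) (X₂ : ZMod q₁₂) (Y₂ : ZMod q₁₂)
      (X₁₂ : ZMod q₁₂) (Y₁₂ : ZMod q₁₂) = true)
    (hw₁₂ : tCosetFree V q₁₂ (x₈ : ZMod q₁₂) (y₈ : ZMod q₁₂) (X₁₂ : ZMod q₁₂) (Y₁₂ : ZMod q₁₂)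
      (A₁₂ : ZMod q₁₂) (B₁₂ : ZMod q₁₂) = true) :
    2 ≤ (V.map (Int.castRingHom ℚ)).mordellWeilRank := by
  classical
  have hΔ : V.Δ ≠ 0 := Δ_ne_zero_of_not_dvd V hq₁
  haveI := isElliptic_rat V hΔ
  have hm' : Odd (m : ℤ) := by exact_mod_cast Nat.odd_iff.mpr hm
  have htors : ∀ x : (V.map (Int.castRingHom ℚ)).toAffine.Point, IsOfFinAddOrder x →
      ((2 : ℤ) ^ 3 * (m : ℤ)) • x = 0 :=
    fun x hx => torsion_zsmul_eq_zero_of_eightTorsionWitness V hte hS ht hT hT2 h₄ htan₄ h₈ htan₈ h₈'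
      hchord ℓ₁ hℓ₁ hodd hB₁ hB₂ hB₂' ℓ₂ hℓ₂ hB₃ x hx
  have h8 := eightTorsion_eq V hT hT2 h₄ htan₄ h₈ htan₈ h₈' hchord ℓ₁ hℓ₁ hodd hB₁ hB₂ hB₂'
  have h2T₄ := some_add_self_of_intTangent V hΔ h₄ hT htan₄
  have h2T₈ := some_add_self_of_intTangent V hΔ h₈ h₄ htan₈
  have h38 := some_add_some_of_intChord V hΔ h₈ h₄ h₈' hchord
  have e₈ : V.toAffine.Equation x₈ y₈ := (Affine.equation_iff x₈ y₈).mpr h₈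
  have e₁ : V.toAffine.Equation X₁ Y₁ := (Affine.equation_iff X₁ Y₁).mpr h₁
  have e₂ : V.toAffine.Equation X₂ Y₂ := (Affine.equation_iff X₂ Y₂).mpr h₂
  refine two_le_mordellWeilRank_of_cosetWitness (V.map (Int.castRingHom ℚ)) hm' htors
    (P₁ := .some _ _ (nonsingular_rat_of_eq V hΔ h₁))
    (P₂ := .some _ _ (nonsingular_rat_of_eq V hΔ h₂))
    (AddMonoidHom.id _) (AddMonoidHom.id _) (AddMonoidHom.id _) ?_ ?_ ?_
  · exact not_mem_twoCoset_three_of_tCosetFree V q₁ hq₁ h2T₄ h2T₈ h38 h8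
      (reduceMod_some V q₁ hq₁ e₈ _) (reduceMod_some V q₁ hq₁ e₁ _) hw₁
  · exact not_mem_twoCoset_three_of_tCosetFree V q₂ hq₂ h2T₄ h2T₈ h38 h8
      (reduceMod_some V q₂ hq₂ e₈ _) (reduceMod_some V q₂ hq₂ e₂ _) hw₂
  · obtain ⟨h', e⟩ := exists_some_add_some_of_zmodChord V q₁₂
      (nonsingular_zmod_of_equation V q₁₂ hq₁₂ e₁) (nonsingular_zmod_of_equation V q₁₂ hq₁₂ e₂) hc₁₂
    refine not_mem_twoCoset_three_of_tCosetFree V q₁₂ hq₁₂ h2T₄ h2T₈ h38 h8 (hns := h')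
      (reduceMod_some V q₁₂ hq₁₂ e₈ _) ?_ hw₁₂
    rw [AddMonoidHom.id_apply, map_add, reduceMod_some V q₁₂ hq₁₂ e₁, reduceMod_some V q₁₂ hq₁₂ e₂, e]

end Assembly

end Summit.BirchSwinnertonDyer.BirchSwinnertonDyer.Rank2Observatory
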